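import Mathlib.RingTheory.ZMod.UnitsCyclic
import Mathlib.Data.ZMod.Units
import Mathlib.FieldTheory.Finite.Basic
import Mathlib.Tactic.IntervalCases
import Mathlib.Tactic.NormNum.Prime
import Mathlib.Tactic.Linarith
import Mathlib.Tactic.Ring
import HarnessLib

/-!
# Arithmetic of conductors `N` with `φ(N)` a power of `2`: Fermat prime factors, `−1` versus squares and high powers

COR-CM (cell `pub-hodgecm2`), binder seat b04 (gen 18), count-neutral claim ABELIAN-ODD-PART, sequel CYCLOTOMIC-2POWER,
part A′ (pure arithmetic, Mathlib only).  KERNEL ONLY: theorems; no definition, no named fact, no `sorry`.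

Ingredients for the `2`-power cyclotomic classification (`CorCM/CyclotomicFieldsTwoPowerClassification`):
* `sub_one_dvd_totient` (`p − 1 ∣ φ(N)` for a prime `p ∣ N`: the units mod `N` map onto the units mod `p`),
  `not_sq_dvd_of_totient_two_pow`, `exists_sub_one_eq_two_pow`, `four_dvd_sub_one` (prime factors of a conductor
  of `2`-power degree are `2` or Fermat primes), `not_seven_dvd_not_eleven_dvd`;
* `mul_self_ne_neg_one_of_four_dvd` / `_of_three_dvd` (`−1` is not a square mod `N` when `4 ∣ N` or `3 ∣ N`);
* **`pow_ne_neg_one_of_two_primes`** (two distinct primes `p, q ∉ {2,3}` dividing `N`, `φ(N) = 2^k`: `−1` is not a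
  `2^{k−2}`-th power of a unit mod `N` — Fermat's little theorem mod `p`, since `4(p − 1) ∣ φ(N)`);
* `exists_two_primes_of_not_isCyclic` (non-cyclic `(ℤ/N)ˣ`, `4 ∤ N`, `3 ∤ N` ⟹ two such primes, by Mathlib's
  `ZMod.isCyclic_units_iff`), `eq_of_dvd_240_of_totient` (divisors of `240` with `φ = 16`: `40, 48, 60`).

## References

* [Washington1997] L. C. Washington, *Introduction to Cyclotomic Fields*, Thm. 2.5 and Ch. 2.

Provenance: Literature home (family `hodge`, namespace `Literature.NumberTheory.NumberFields.TotientTwoPower`) of the Summits-side `CorCM/TotientTwoPowerArithmetic` (cell `pub-hodgecm2`, COR-CM; all its imports are `Literature/` and Mathlib), which `Literature/` may not import; theorems only, no named fact, no definition. Nothing here bears on `HC_CM`. Lane `lit-hodgefound` (Layer A3: CM types, their Kubota ranks and Galois combinatorics), seat p20.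
-/

namespace Literature.NumberTheory.NumberFields.TotientTwoPower

section Arith

variable {N : ℕ}

/-- `p − 1 ∣ φ(N)` for a prime `p ∣ N` (the units mod `N` map ONTO the units mod `p`). [cite: Washington1997, Thm. 2.5] -/
theorem sub_one_dvd_totient [NeZero N] {p : ℕ} (hp : p.Prime) (hpN : p ∣ N) : p - 1 ∣ N.totient := by
  haveI : Fact p.Prime := ⟨hp⟩
  have h := Subgroup.card_dvd_of_surjective (ZMod.unitsMap hpN) (ZMod.unitsMap_surjective hpN)
  rwa [Nat.card_eq_fintype_card, Nat.card_eq_fintype_card, ZMod.card_units_eq_totient,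
    ZMod.card_units_eq_totient, Nat.totient_prime hp] at h

/-- `p(p − 1) ∣ φ(N)` when `p² ∣ N`; so `p² ∤ N` for an odd prime `p` when `φ(N)` is a power of `2`. [cite: Washington1997, Thm. 2.5] -/
theorem not_sq_dvd_of_totient_two_pow [NeZero N] {k p : ℕ} (hφ : N.totient = 2 ^ k) (hp : p.Prime)
    (hp2 : p ≠ 2) : ¬ p ^ 2 ∣ N := by
  intro h
  haveI : Fact p.Prime := ⟨hp⟩
  haveI : NeZero (p ^ 2) := ⟨pow_ne_zero 2 hp.ne_zero⟩
  have hd := Subgroup.card_dvd_of_surjective (ZMod.unitsMap h) (ZMod.unitsMap_surjective h)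
  rw [Nat.card_eq_fintype_card, Nat.card_eq_fintype_card, ZMod.card_units_eq_totient, ZMod.card_units_eq_totient,
    Nat.totient_prime_pow hp two_pos, hφ, show 2 - 1 = 1 from rfl, pow_one] at hd
  have hpd : p ∣ 2 ^ k := dvd_trans (Dvd.intro _ rfl) hd
  exact hp2 ((Nat.prime_dvd_prime_iff_eq hp Nat.prime_two).1 (hp.dvd_of_dvd_pow hpd))

/-- A prime `p ∣ N` with `φ(N) = 2^k`: `p − 1 = 2^s` is a power of `2`. [cite: Washington1997, Thm. 2.5] -/
theorem exists_sub_one_eq_two_pow [NeZero N] {k p : ℕ} (hφ : N.totient = 2 ^ k) (hp : p.Prime) (hpN : p ∣ N) :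
    ∃ s ≤ k, p - 1 = 2 ^ s := by
  have h := sub_one_dvd_totient hp hpN
  rw [hφ] at h
  obtain ⟨s, hs, h'⟩ := (Nat.dvd_prime_pow Nat.prime_two).1 h
  exact ⟨s, hs, h'⟩

/-- A prime `p ∣ N`, `p ∉ {2, 3}`, `φ(N) = 2^k`: `4 ∣ p − 1`. [cite: Washington1997, Thm. 2.5] -/
theorem four_dvd_sub_one [NeZero N] {k p : ℕ} (hφ : N.totient = 2 ^ k) (hp : p.Prime) (hpN : p ∣ N) (hp2 : p ≠ 2)
    (hp3 : p ≠ 3) : 4 ∣ p - 1 := by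
  obtain ⟨s, -, hs⟩ := exists_sub_one_eq_two_pow hφ hp hpN
  have h2 := hp.two_le
  have hs2 : 2 ≤ s := by
    by_contra hlt
    interval_cases s <;> simp at hs <;> omega
  rw [hs]
  have h := Nat.pow_dvd_pow 2 hs2
  norm_num at h
  exact h

/-- `7 ∤ N` and `11 ∤ N` when `φ(N)` is a power of `2`. [cite: Washington1997, Thm. 2.5] -/
theorem not_seven_dvd_not_eleven_dvd [NeZero N] {k : ℕ} (hφ : N.totient = 2 ^ k) : ¬ 7 ∣ N ∧ ¬ 11 ∣ N := by
  constructor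
  · intro h
    obtain ⟨s, -, hs⟩ := exists_sub_one_eq_two_pow hφ (by norm_num) h
    have : (2 : ℕ) ^ s % 3 = 0 := by omega
    have h3 : (3 : ℕ) ∣ 2 ^ s := Nat.dvd_of_mod_eq_zero this
    have := (Nat.prime_dvd_prime_iff_eq Nat.prime_three Nat.prime_two).1 (Nat.prime_three.dvd_of_dvd_pow h3)
    norm_num at this
  · intro h
    obtain ⟨s, -, hs⟩ := exists_sub_one_eq_two_pow hφ (by norm_num) h
    have : (2 : ℕ) ^ s % 5 = 0 := by omega
    have h5 : (5 : ℕ) ∣ 2 ^ s := Nat.dvd_of_mod_eq_zero this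
    have := (Nat.prime_dvd_prime_iff_eq (by norm_num : Nat.Prime 5) Nat.prime_two).1
      ((by norm_num : Nat.Prime 5).dvd_of_dvd_pow h5)
    norm_num at this

/-- `−1` is not a square mod `N` when `4 ∣ N`. [cite: Washington1997, Thm. 2.5] -/
theorem mul_self_ne_neg_one_of_four_dvd (h4 : 4 ∣ N) (x : ZMod N) : x * x ≠ -1 := by
  intro h
  have h' := congrArg (ZMod.castHom h4 (ZMod 4)) h
  rw [map_mul, map_neg, map_one] at h'
  revert h'
  generalize ZMod.castHom h4 (ZMod 4) x = y
  decide +revert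

/-- `−1` is not a square mod `N` when `3 ∣ N`. [cite: Washington1997, Thm. 2.5] -/
theorem mul_self_ne_neg_one_of_three_dvd (h3 : 3 ∣ N) (x : ZMod N) : x * x ≠ -1 := by
  intro h
  have h' := congrArg (ZMod.castHom h3 (ZMod 3)) h
  rw [map_mul, map_neg, map_one] at h'
  revert h'
  generalize ZMod.castHom h3 (ZMod 3) x = y
  decide +revert

/-- **Fermat obstruction.**  `φ(N) = 2^k`, `p ≠ q` primes dividing `N`, `p, q ∉ {2, 3}`: `−1` is not a
`2^{k−2}`-th power of a unit residue mod `N` (`2^{k−2} = (p − 1)·φ(N/p)/4` and `a^{p−1} ≡ 1 (mod p)`).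
[cite: Washington1997, Thm. 2.5] -/
theorem pow_ne_neg_one_of_two_primes [NeZero N] {k p q : ℕ} (hφ : N.totient = 2 ^ k) (hp : p.Prime) (hq : q.Prime)
    (hpq : p ≠ q) (hpN : p ∣ N) (hqN : q ∣ N) (hp2 : p ≠ 2) (hp3 : p ≠ 3) (hq2 : q ≠ 2) (hq3 : q ≠ 3)
    {a : ZMod N} (ha : a.val.Coprime N) : a ^ 2 ^ (k - 2) ≠ -1 := by
  haveI : Fact p.Prime := ⟨hp⟩
  -- `N = p · M`, `p ∤ M`, `q ∣ M`
  obtain ⟨M, hM⟩ := hpN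
  have hpM : ¬ p ∣ M := fun h => not_sq_dvd_of_totient_two_pow hφ hp hp2
    (by rw [hM, pow_two]; exact Nat.mul_dvd_mul_left p h)
  haveI : NeZero M := ⟨fun h => NeZero.ne N (by rw [hM, h, mul_zero])⟩
  have hqM : q ∣ M := by
    have h := hqN
    rw [hM] at h
    exact ((Nat.Prime.dvd_mul hq).1 h).resolve_left fun h' =>
      hpq ((Nat.prime_dvd_prime_iff_eq hq hp).1 h').symm
  have hφM : N.totient = (p - 1) * M.totient := by
    rw [hM, Nat.totient_mul ((Nat.Prime.coprime_iff_not_dvd hp).2 hpM), Nat.totient_prime hp]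
  -- `4 ∣ φ(M)` via `q`, so `2^{k-2} = (p-1) · (φ(M)/4)`
  have hφMk : M.totient ∣ 2 ^ k := by rw [← hφ, hφM]; exact Dvd.intro_left _ rfl
  obtain ⟨t, -, ht⟩ := (Nat.dvd_prime_pow Nat.prime_two).1 hφMk
  have h4M : 4 ∣ M.totient := dvd_trans (four_dvd_sub_one (N := M) ht hq hqM hq2 hq3) (sub_one_dvd_totient hq hqM)
  obtain ⟨e, he⟩ := h4M
  have hexp : 2 ^ (k - 2) = (p - 1) * e := by
    have h1 : 2 ^ k = (p - 1) * (4 * e) := by rw [← hφ, hφM, he]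
    have he1 : 1 ≤ e := by
      have hpos : 0 < M.totient := Nat.totient_pos.2 (Nat.pos_of_ne_zero (NeZero.ne M))
      omega
    have hp4 : p ≠ 4 := fun h => by rw [h] at hp; norm_num at hp
    have hp5 : 5 ≤ p := by have := hp.two_le; omega
    have h16 : 16 ≤ 2 ^ k := by
      rw [h1]
      have hp1 : 4 ≤ p - 1 := by omega
      exact Nat.mul_le_mul hp1 (by omega : 4 ≤ 4 * e)
    have hk4 : 4 ≤ k := by
      by_contra hlt
      have : 2 ^ k ≤ 2 ^ 3 := Nat.pow_le_pow_right two_pos (by omega)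
      omega
    have h2 : 2 ^ k = 4 * 2 ^ (k - 2) := by
      rw [show (4 : ℕ) = 2 ^ 2 by norm_num, ← pow_add]; congr 1; omega
    have h3 : 4 * 2 ^ (k - 2) = 4 * ((p - 1) * e) := by rw [← h2, h1]; ring
    exact Nat.eq_of_mul_eq_mul_left (by norm_num : 0 < 4) h3
  -- reduce mod `p`
  intro h
  have hcast := congrArg (ZMod.castHom (show p ∣ N from ⟨M, hM⟩) (ZMod p)) h
  rw [map_pow, map_neg, map_one, hexp, pow_mul] at hcast
  set b : ZMod p := ZMod.castHom (show p ∣ N from ⟨M, hM⟩) (ZMod p) a with hb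
  have hb0 : b ≠ 0 := by
    intro hb0
    -- `p ∣ a.val` contradicts `gcd(a.val, N) = 1`
    have hval : (a.val : ZMod p) = 0 := by
      rw [← hb0, hb, ← ZMod.natCast_zmod_val a, map_natCast, ZMod.natCast_zmod_val]
    rw [ZMod.natCast_eq_zero_iff] at hval
    have : p ∣ Nat.gcd a.val N := Nat.dvd_gcd hval ⟨M, hM⟩
    rw [ha] at this
    exact hp.one_lt.ne' (Nat.dvd_one.1 this)
  rw [ZMod.pow_card_sub_one_eq_one hb0, one_pow] at hcast
  -- `1 = -1` in `ZMod p` forces `p ∣ 2`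
  have h2 : ((2 : ℕ) : ZMod p) = 0 := by
    rw [Nat.cast_ofNat, show (2 : ZMod p) = 1 + 1 by norm_num]
    nth_rewrite 1 [hcast]
    rw [neg_add_cancel]
  rw [ZMod.natCast_eq_zero_iff] at h2
  exact hp2 ((Nat.prime_dvd_prime_iff_eq hp Nat.prime_two).1 h2)

/-- **Non-cyclic `(ℤ/N)ˣ` with `4 ∤ N`, `3 ∤ N`, `N ≥ 3`: two distinct primes `p, q ∉ {2, 3}` divide `N`.**
(Mathlib `ZMod.isCyclic_units_iff`: the odd part of `N` is not a prime power.) [cite: Washington1997, Thm. 2.5] -/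
theorem exists_two_primes_of_not_isCyclic (hN : 3 ≤ N) (h4 : ¬ 4 ∣ N) (h3 : ¬ 3 ∣ N)
    (hnc : ¬ IsCyclic (ZMod N)ˣ) :
    ∃ p q : ℕ, p.Prime ∧ q.Prime ∧ p ≠ q ∧ p ∣ N ∧ q ∣ N ∧ p ≠ 2 ∧ p ≠ 3 ∧ q ≠ 2 ∧ q ≠ 3 := by
  -- the odd part `F` of `N`: `N = F` or `N = 2F`
  obtain ⟨F, hFodd, hFN, hNF⟩ : ∃ F : ℕ, Odd F ∧ F ∣ N ∧ (N = F ∨ N = 2 * F) := by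
    rcases Nat.even_or_odd N with ⟨F, hF⟩ | hodd
    · refine ⟨F, ?_, ⟨2, by omega⟩, Or.inr (by omega)⟩
      by_contra hev
      rw [Nat.not_odd_iff_even] at hev
      obtain ⟨G, hG⟩ := hev
      exact h4 ⟨G, by omega⟩
    · exact ⟨N, hodd, dvd_rfl, Or.inl rfl⟩
  have hF1 : F ≠ 1 := by
    rintro rfl
    rcases hNF with h | h <;> omega
  have hF0 : F ≠ 0 := fun h => by rw [h] at hFodd; exact (Nat.not_odd_iff_even.2 (by decide)) hFodd
  -- `p = minFac F`
  set p := F.minFac with hp_def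
  have hp : p.Prime := Nat.minFac_prime hF1
  have hpF : p ∣ F := Nat.minFac_dvd F
  -- `F` is not a power of `p`
  have hnot : ¬ ∀ {d : ℕ}, d.Prime → d ∣ F → d = p := by
    intro hall
    have hFeq := Nat.eq_prime_pow_of_unique_prime_dvd hF0 hall
    set m := F.primeFactorsList.length
    have hm1 : 1 ≤ m := by
      by_contra hm
      have hm0 : m = 0 := by omega
      rw [hm0, pow_zero] at hFeq
      exact hF1 hFeq
    have hpodd : Odd p := hFodd.of_dvd_nat hpF
    apply hnc
    rw [ZMod.isCyclic_units_iff]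
    refine Or.inr (Or.inr (Or.inr (Or.inr ⟨p, m, hp, hpodd, hm1, ?_⟩)))
    rcases hNF with h | h
    · exact Or.inl (h.trans hFeq)
    · exact Or.inr (by rw [h, hFeq])
  push Not at hnot
  obtain ⟨q, hq, hqF, hqp⟩ := hnot
  have hp2 : p ≠ 2 := fun h => by
    have := hFodd.of_dvd_nat hpF; rw [h] at this; exact (Nat.not_odd_iff_even.2 even_two) this
  have hq2 : q ≠ 2 := fun h => by
    have := hFodd.of_dvd_nat hqF; rw [h] at this; exact (Nat.not_odd_iff_even.2 even_two) this
  refine ⟨p, q, hp, hq, fun h => hqp h.symm, dvd_trans hpF hFN, dvd_trans hqF hFN, hp2, ?_, hq2, ?_⟩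
  · intro h
    rw [h] at hpF
    exact h3 (dvd_trans hpF hFN)
  · intro h
    rw [h] at hqF
    exact h3 (dvd_trans hqF hFN)

/-- The divisors of `240` with `φ = 16` are `40, 48, 60`. [cite: Washington1997, Thm. 2.5] -/
theorem eq_of_dvd_240_of_totient (hd : N ∣ 240) (hφ : N.totient = 16) : N = 40 ∨ N = 48 ∨ N = 60 := by
  have hmem : N ∈ Nat.divisors 240 := Nat.mem_divisors.2 ⟨hd, by norm_num⟩
  have key : ∀ d ∈ Nat.divisors 240, Nat.totient d = 16 → d = 40 ∨ d = 48 ∨ d = 60 := by decide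
  exact key N hmem hφ

end Arith

end Literature.NumberTheory.NumberFields.TotientTwoPower
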